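import Summits.ValiantsHypothesis.ValiantsHypothesis.Theorems.NNDivisionHard.Negative.WeakReliefBlindPermutahedron

/-!
# The weak-relief blindness identity, part 4 (§4): the SMALL column classes `[|P_{|a|}(π) ∩ b| ≤ 1]` of the untilted clique matrix are blind for EVERY integer `λ ≥ 1`

PORT NOTE (staged by the AUTHOR val-idea-39 g4 for the Negative-lane port hand named by the desk — val-port-3 g3 per #365 (B)/#367; critic of record val-idea-crit-9 g2, V#66 booked §3 as N22's β-kernel leg): texts VERBATIM BY NAME from the crux workfile `Cruxes/NNDivisionHard/WeakReliefBlind39.lean` rev 5 @7c4a19848ae2 (sha16 c2e19d8d627dfa6a, lint-clean); the ONLY changes are the namespace (= parts 1–2, ✓ p679897 / ✓ p680161), the 400-line-cap SPLIT, and one-line docstrings on helper lemmas (gate lint).  VP ≠ VNP is NOT proved; the crux `NNDivisionHard` stays OPEN; `LocatedPencilLaw` is refuted in the kernel by ✓ p679540 (crit-9 α-leg) — these files are an INDEPENDENT certificate at the `{0,1}`-tilt level with λ ≥ 4n+2 (parts 3a/3b) and, here, the small-class theorem for all λ ≥ 1; this part imports part 2 only (the `inv` split is re-derived from `invInd_s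plit`).

§4 (author's docstring, verbatim).  The SMALL column classes are blind for EVERY `λ ≥ 1`

The relief `β = |a|` of §2 is consumed only in the column class `p = |P_{|a|}(π) ∩ b| ≥ 2` (§1 MECHANISM, the charge `(p−s)·t ≤ |a|`);
in the classes `p ∈ {0,1}` the two `β`-carrying families of `weak_identity` cancel.  Switching them off and lowering the boundary
family to `X_lX_{l₂}(λ − [l = l₂])` gives a nonnegative certificate of the CLASS-RESTRICTED matrix
`[|P_{|a|}(π) ∩ b| ≤ 1]·((1 − |a∩b|)² + λ·inv(a;π))` for every integer `λ ≥ 1` with the SAME slot type `PIdx n`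
(`(n+1)(4n²+4n+1)` slots).  So the untilted small-λ residue `λ ∈ {1,…,|a|}` of the §2 docstring lives entirely on the columns whose
located prefix meets `b` at least twice (memo `Cruxes/NNDivisionHard/SmallLambda39.md`).
-/

-- the mandated summit-side namespace repeats a component by design (single-problem summit)
set_option linter.dupNamespace false

namespace Summit.ValiantsHypothesis.Theorems.NNDivisionHardNegative.WeakReliefBlind

open Finset
open Summit.ValiantsHypothesis.Theorems.NNDivisionHardNegative.BlindCubeIdentity
  (ind ind_nonneg ind_le_one ind_mul_self ind_inter sum_ind sum_ind_mul sum_ite_eq_sub)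

section SmallClass
variable {n : ℕ}

/-- small column class indicator `[|P ∩ b| ≤ 1]` -/
def cSmall (b P : Finset (Fin n)) : ℤ := if (P ∩ b).card ≤ 1 then 1 else 0

/-- `cSmall ≥ 0` -/
theorem cSmall_nonneg (b P : Finset (Fin n)) : 0 ≤ cSmall b P := by
  unfold cSmall; split_ifs <;> norm_num

/-- column factors of the small-class weak certificate: `cSmall • weakCol` with the two `β`-carrying families (4th and 7th) off -/
def smallWeakCol (b P : Finset (Fin n)) : WIdx n → ℤ
  | Sum.inl u => cSmall b P * weakCol b P (Sum.inl u)
  | Sum.inr (Sum.inl i) => cSmall b P * weakCol b P (Sum.inr (Sum.inl i))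
  | Sum.inr (Sum.inr (Sum.inl im)) => cSmall b P * weakCol b P (Sum.inr (Sum.inr (Sum.inl im)))
  | Sum.inr (Sum.inr (Sum.inr (Sum.inl _))) => 0
  | Sum.inr (Sum.inr (Sum.inr (Sum.inr (Sum.inl i)))) => cSmall b P * weakCol b P (Sum.inr (Sum.inr (Sum.inr (Sum.inr (Sum.inl i)))))
  | Sum.inr (Sum.inr (Sum.inr (Sum.inr (Sum.inr (Sum.inl i))))) =>
      cSmall b P * weakCol b P (Sum.inr (Sum.inr (Sum.inr (Sum.inr (Sum.inr (Sum.inl i))))))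
  | Sum.inr (Sum.inr (Sum.inr (Sum.inr (Sum.inr (Sum.inr _))))) => 0

/-- small-class weak column factors are nonnegative -/
theorem smallWeakCol_nonneg (b P : Finset (Fin n)) (idx : WIdx n) : 0 ≤ smallWeakCol b P idx := by
  have hc := cSmall_nonneg b P
  rcases idx with u | i | im | im | i | i | i <;> simp only [smallWeakCol] <;>
    first | exact le_rfl | exact mul_nonneg hc (weakCol_nonneg b P _)

/-- ★ the small-class weak identity: `[|P∩b| ≤ 1]·((1 − |a∩b|)² + |a∖P|) = Σ_idx weakRow 1 |a| a idx · smallWeakCol b P idx`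
(unit relief on the missing side only; no relief at all on the extra side). -/
theorem smallWeak_identity (a b P : Finset (Fin n)) :
    cSmall b P * ((1 - ((a ∩ b).card : ℤ)) ^ 2 + ((a.card : ℤ) - ((a ∩ P).card : ℤ))) =
      ∑ idx : WIdx n, weakRow 1 (a.card : ℤ) a idx * smallWeakCol b P idx := by
  classical
  by_cases h : (P ∩ b).card ≤ 1
  · have hc : cSmall b P = 1 := by simp [cSmall, h]
    have hc2 : cTwo b P = 0 := by simp [cTwo]; omega
    have hw := weak_identity 1 (a.card : ℤ) a b P
    rw [weakLHS, sum_WIdx] at hw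
    rw [sum_WIdx]
    simp only [weakRow, weakCol, smallWeakCol, hc, hc2, one_mul, zero_mul, mul_zero, sub_zero, mul_one, sub_self,
      Finset.sum_const_zero, add_zero] at hw ⊢
    have hB4 : ∑ i, ∑ m, (1 - ind a i) * ind a m * ind P i = ((P.card : ℤ) - ((a ∩ P).card : ℤ)) * (a.card : ℤ) := by
      have e : ∀ i, ∑ m, (1 - ind a i) * ind a m * ind P i = ((1 - ind a i) * ind P i) * ∑ m, ind a m := by
        intro i; rw [Finset.mul_sum]; exact Finset.sum_congr rfl fun m _ => by ring
      rw [Finset.sum_congr rfl (fun i _ => e i), ← Finset.sum_mul, sum_ind a]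
      have : ∑ i, (1 - ind a i) * ind P i = (P.card : ℤ) - ((a ∩ P).card : ℤ) := by
        rw [← sum_ind P, ← sum_ind_mul a P, ← Finset.sum_sub_distrib]
        exact Finset.sum_congr rfl fun i _ => by ring
      rw [this]
    rw [hB4] at hw
    linarith
  · have hc : cSmall b P = 0 := by simp [cSmall, h]
    rw [sum_WIdx]
    simp only [weakRow, smallWeakCol, hc, zero_mul, mul_zero, Finset.sum_const_zero, add_zero]

/-- row factors at size class `k` for the small classes: weak rows at `(1, |a|)`, recourse rows `λX_l(1−X_{l′})`, boundary rows
`X_lX_{l₂}(λ − [l = l₂])` — nonnegative as soon as `λ ≥ 1`. -/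
def smallRow (lam : ℤ) (a : Finset (Fin n)) : WIdx n ⊕ (Fin n × Fin n) ⊕ (Fin n × Fin n) → ℤ
  | Sum.inl idx => weakRow 1 (a.card : ℤ) a idx
  | Sum.inr (Sum.inl (l, l')) => lam * (ind a l * (1 - ind a l'))
  | Sum.inr (Sum.inr (l, l₂)) => ind a l * ind a l₂ * (lam - (if l = l₂ then 1 else 0))

/-- column factors at size class `k` for the small classes (everything carries the class indicator `[|P_k(π) ∩ b| ≤ 1]`) -/
def smallCol (b : Finset (Fin n)) (π : Equiv.Perm (Fin n)) (k : ℕ) : WIdx n ⊕ (Fin n × Fin n) ⊕ (Fin n × Fin n) → ℤ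
  | Sum.inl idx => smallWeakCol b (posLT π k) idx
  | Sum.inr (Sum.inl (l, l')) =>
      cSmall b (posLT π k) * (((1 - pInd π k l) * (1 - pInd π k l') + pInd π k l * pInd π k l') * invInd π l l')
  | Sum.inr (Sum.inr (l, l₂)) => cSmall b (posLT π k) * ((1 - pInd π k l) * (1 - pInd π k l₂))

/-- small-class row factors are nonnegative for `λ ≥ 1` -/
theorem smallRow_nonneg {lam : ℤ} {a : Finset (Fin n)} (hlam : 1 ≤ lam) (s) : 0 ≤ smallRow lam a s := by
  have h0 := ind_nonneg a; have h1 := ind_le_one a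
  rcases s with idx | ⟨l, l'⟩ | ⟨l, l₂⟩ <;> simp only [smallRow]
  · exact weakRow_nonneg le_rfl le_rfl idx
  · exact mul_nonneg (by linarith) (mul_nonneg (h0 l) (by linarith [h1 l']))
  · refine mul_nonneg (mul_nonneg (h0 l) (h0 l₂)) ?_
    split_ifs <;> linarith

/-- small-class column factors are nonnegative -/
theorem smallCol_nonneg (b : Finset (Fin n)) (π : Equiv.Perm (Fin n)) (k : ℕ) (s) : 0 ≤ smallCol b π k s := by
  have h0 := pInd_nonneg π k; have h1 := pInd_le_one π k
  have hc := cSmall_nonneg b (posLT π k)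
  rcases s with idx | ⟨l, l'⟩ | ⟨l, l₂⟩ <;> simp only [smallCol]
  · exact smallWeakCol_nonneg b _ idx
  · refine mul_nonneg hc (mul_nonneg ?_ (invInd_nonneg π l l'))
    nlinarith [h0 l, h1 l, h0 l', h1 l', mul_nonneg (h0 l) (h0 l'),
      mul_nonneg (by linarith [h1 l] : (0:ℤ) ≤ 1 - pInd π k l) (by linarith [h1 l'] : (0:ℤ) ≤ 1 - pInd π k l')]
  · exact mul_nonneg hc (mul_nonneg (by linarith [h1 l]) (by linarith [h1 l₂]))

/-- ★★ **THE SMALL-CLASS PERMUTAHEDRAL IDENTITY** (all `n`, all `λ`, every row `a` and column `(b, π)`; sorry-free):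
`[|P∩b| ≤ 1]·((1 − |a∩b|)² + λ·inv(a;π)) = Σ_WIdx weakRow 1 |a| a · smallWeakCol b P`   (`P = P_{|a|}(π)`, no extra-side relief)
` + [|P∩b| ≤ 1]·Σ_{l,l′} λ X_l(1−X_{l′}) · ([l,l′ ∉ P] + [l,l′ ∈ P])[π(l′)<π(l)]`   (inversions inside `Pᶜ×Pᶜ` and `P×P`)
` + [|P∩b| ≤ 1]·Σ_{l,l₂} X_l X_{l₂}(λ − [l=l₂]) · [l ∉ P][l₂ ∉ P]`   (`λd² − d`, paid by the `d²` boundary inversions as soon as `λ ≥ 1`). -/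
theorem smallInv_identity (lam : ℤ) (a b : Finset (Fin n)) (π : Equiv.Perm (Fin n)) :
    cSmall b (posLT π a.card) * ((1 - ((a ∩ b).card : ℤ)) ^ 2 + lam * inv a π) =
      (∑ idx : WIdx n, weakRow 1 (a.card : ℤ) a idx * smallWeakCol b (posLT π a.card) idx) +
      ((∑ l, ∑ l', (lam * (ind a l * (1 - ind a l'))) *
          (cSmall b (posLT π a.card) *
            ((((1 - pInd π a.card l) * (1 - pInd π a.card l') + pInd π a.card l * pInd π a.card l') * invInd π l l')))) +
       (∑ l, ∑ l₂, (ind a l * ind a l₂ * (lam - (if l = l₂ then 1 else 0))) *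
          (cSmall b (posLT π a.card) * ((1 - pInd π a.card l) * (1 - pInd π a.card l₂))))) := by
  classical
  rw [← smallWeak_identity]
  set P := posLT π a.card with hPdef
  set cS : ℤ := cSmall b P with hcS
  have hkn : a.card ≤ n := by simpa using Finset.card_le_univ a
  have hPk : (P.card : ℤ) = (a.card : ℤ) := by rw [hPdef]; exact_mod_cast card_posLT π hkn
  have hX2 := ind_mul_self a
  have hP2 := pInd_mul_self π a.card
  have hPi : ∀ l, ind P l = pInd π a.card l := fun l => by rw [hPdef]; exact ind_posLT π a.card l
  -- (1) the recourse splits along `P` (as in part 2's `permInv_identity`, from `invInd_split`)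
  have hinv : inv a π = (∑ l, ind a l * (1 - pInd π a.card l)) * (∑ l, (1 - ind a l) * pInd π a.card l) +
      ∑ l, ∑ l', ind a l * (1 - ind a l') *
        (((1 - pInd π a.card l) * (1 - pInd π a.card l') + pInd π a.card l * pInd π a.card l') * invInd π l l') := by
    unfold inv
    rw [Finset.sum_mul_sum, ← Finset.sum_add_distrib]
    refine Finset.sum_congr rfl fun l _ => ?_
    rw [← Finset.sum_add_distrib]
    refine Finset.sum_congr rfl fun l' _ => ?_
    conv_lhs => rw [invInd_split π a.card l l']
    ring
  -- (2) the boundary family is `cS·(λ x² − x)`, `x = Σ X_l (1 − Π_l)`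
  have hbd : ∑ l, ∑ l₂, (ind a l * ind a l₂ * (lam - (if l = l₂ then 1 else 0))) *
        (cS * ((1 - pInd π a.card l) * (1 - pInd π a.card l₂))) =
      cS * (lam * (∑ l, ind a l * (1 - pInd π a.card l)) ^ 2 - ∑ l, ind a l * (1 - pInd π a.card l)) := by
    have e : ∀ l l₂, (ind a l * ind a l₂ * (lam - (if l = l₂ then 1 else 0))) *
        (cS * ((1 - pInd π a.card l) * (1 - pInd π a.card l₂))) =
        cS * (lam * ((ind a l * (1 - pInd π a.card l)) * (ind a l₂ * (1 - pInd π a.card l₂)))) -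
          cS * (if l = l₂ then (ind a l * (1 - pInd π a.card l)) * (ind a l₂ * (1 - pInd π a.card l₂)) else 0) := by
      intro l l₂; split_ifs <;> ring
    have idem : ∀ l, (ind a l * (1 - pInd π a.card l)) * (ind a l * (1 - pInd π a.card l)) = ind a l * (1 - pInd π a.card l) := by
      intro l
      linear_combination ((1 - pInd π a.card l) * (1 - pInd π a.card l)) * hX2 l + ind a l * hP2 l
    have inner : ∀ l, ∑ l₂, (ind a l * ind a l₂ * (lam - (if l = l₂ then 1 else 0))) *
        (cS * ((1 - pInd π a.card l) * (1 - pInd π a.card l₂))) =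
        cS * (lam * ((ind a l * (1 - pInd π a.card l)) * ∑ l₂, ind a l₂ * (1 - pInd π a.card l₂))) -
          cS * (ind a l * (1 - pInd π a.card l)) := by
      intro l
      rw [Finset.sum_congr rfl (fun l₂ _ => e l l₂), Finset.sum_sub_distrib, ← Finset.mul_sum, ← Finset.mul_sum,
        ← Finset.mul_sum, ← Finset.mul_sum, Finset.sum_ite_eq]
      simp only [Finset.mem_univ, if_true]
      rw [idem l]
    rw [Finset.sum_congr rfl (fun l _ => inner l), Finset.sum_sub_distrib, ← Finset.mul_sum, ← Finset.mul_sum,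
      ← Finset.mul_sum, ← Finset.sum_mul, sq]
    ring
  have hE : ∑ l, ∑ l', (lam * (ind a l * (1 - ind a l'))) *
        (cS * ((((1 - pInd π a.card l) * (1 - pInd π a.card l') + pInd π a.card l * pInd π a.card l') * invInd π l l'))) =
      cS * (lam * ∑ l, ∑ l', ind a l * (1 - ind a l') *
        (((1 - pInd π a.card l) * (1 - pInd π a.card l') + pInd π a.card l * pInd π a.card l') * invInd π l l')) := by
    rw [Finset.mul_sum, Finset.mul_sum]
    refine Finset.sum_congr rfl fun l _ => ?_
    rw [Finset.mul_sum, Finset.mul_sum]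
    exact Finset.sum_congr rfl fun l' _ => by ring
  rw [hinv, hbd, hE]
  -- (3) bookkeeping: x = k − |a∩P| = y
  have sX := sum_ind a
  have sXP : ∑ l, ind a l * pInd π a.card l = ((a ∩ P).card : ℤ) := by
    simp_rw [← hPi]; exact sum_ind_mul a _
  have sP : ∑ l, pInd π a.card l = (P.card : ℤ) := by
    simp_rw [← hPi]; exact sum_ind _
  have hx : ∑ l, ind a l * (1 - pInd π a.card l) = (a.card : ℤ) - ((a ∩ P).card : ℤ) := by
    rw [← sX, ← sXP, ← Finset.sum_sub_distrib]
    exact Finset.sum_congr rfl fun l _ => by ring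
  have hy : ∑ l', (1 - ind a l') * pInd π a.card l' = (P.card : ℤ) - ((a ∩ P).card : ℤ) := by
    rw [← sP, ← sXP, ← Finset.sum_sub_distrib]
    exact Finset.sum_congr rfl fun l _ => by ring
  rw [hx, hy, hPk]
  ring

/-- the identity in packaged form for ONE row -/
theorem smallInv_identity' (lam : ℤ) (a b : Finset (Fin n)) (π : Equiv.Perm (Fin n)) :
    cSmall b (posLT π a.card) * ((1 - ((a ∩ b).card : ℤ)) ^ 2 + lam * inv a π) =
      ∑ s, smallRow lam a s * smallCol b π a.card s := by
  rw [smallInv_identity lam a b π]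
  simp only [Fintype.sum_sum_type, Fintype.sum_prod_type, smallRow, smallCol]

/-- ★★ **`rank₊([|P_{|a|}(π) ∩ b| ≤ 1]·((1 − |a∩b|)² + λ·inv(a;π))) ≤ (n+1)(4n² + 4n + 1)` for every `n` and every integer `λ ≥ 1`**:
nonnegative `U : Finset (Fin n) → PIdx n → ℝ`, `V : Finset (Fin n) × Equiv.Perm (Fin n) → PIdx n → ℝ` with
`[|P_{|a|}(π) ∩ b| ≤ 1]·((1 − |a∩b|)² + λ·inv(a;π)) = Σ_s U a s · V (b,π) s` for ALL rows `a ⊆ [n]` and columns `(b, π)` — the columns whose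
located prefix meets `b` at most once carry no lower bound for ANY `λ ≥ 1`; the small-λ residue is the class `|P_{|a|}(π) ∩ b| ≥ 2`. -/
theorem smallInv_rankPlus_le (n : ℕ) (lam : ℤ) (hlam : 1 ≤ lam) :
    ∃ (U : Finset (Fin n) → PIdx n → ℝ) (V : Finset (Fin n) × Equiv.Perm (Fin n) → PIdx n → ℝ),
      (∀ a s, 0 ≤ U a s) ∧ (∀ bπ s, 0 ≤ V bπ s) ∧
      ∀ (a b : Finset (Fin n)) (π : Equiv.Perm (Fin n)),
        (cSmall b (posLT π a.card) : ℝ) * (((1 : ℝ) - ((a ∩ b).card : ℝ)) ^ 2 + (lam : ℝ) * (inv a π : ℝ)) =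
          ∑ s, U a s * V (b, π) s := by
  classical
  refine ⟨fun a s => if (s.1 : ℕ) = a.card then (smallRow lam a s.2 : ℝ) else 0,
    fun bπ s => (smallCol bπ.1 bπ.2 (s.1 : ℕ) s.2 : ℝ), ?_, ?_, ?_⟩
  · intro a s
    dsimp only
    split_ifs
    · exact_mod_cast smallRow_nonneg hlam s.2
    · exact le_rfl
  · intro bπ s
    dsimp only
    exact_mod_cast smallCol_nonneg bπ.1 bπ.2 _ s.2
  · intro a b π
    have hkn : a.card < n + 1 := by
      have : a.card ≤ n := by simpa using Finset.card_le_univ a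
      omega
    have h := congrArg (fun z : ℤ => (z : ℝ)) (smallInv_identity' lam a b π)
    simp only [Int.cast_add, Int.cast_pow, Int.cast_sub, Int.cast_one, Int.cast_mul, Int.cast_natCast, Int.cast_sum] at h
    rw [h, Fintype.sum_prod_type]
    rw [Finset.sum_eq_single (⟨a.card, hkn⟩ : Fin (n + 1))]
    · simp
    · intro k _ hk
      have : (k : ℕ) ≠ a.card := fun e => hk (Fin.ext e)
      simp [this]
    · intro h; exact absurd (Finset.mem_univ _) h

end SmallClass

end Summit.ValiantsHypothesis.Theorems.NNDivisionHardNegative.WeakReliefBlind
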